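import Summits.ResolutionOfSingularities.ResolutionOfSingularities.Theorems.FrobeniusLadderFInjectiveMacaulayficationRecipeTowerTransfer
import Literature.AlgebraicGeometry.Resolution.RegularSubschemeLocallyIrreducible
import Literature.AlgebraicGeometry.Resolution.ComponentGluing
import HarnessLib

/-!
# NEG-T (T1): the `N_red` centre commutes with flat preimmersions — and NEG-T for `N_red` HYPOTHESIS-FREE
# (crux `FInjectiveMacaulayfication` stmt-ResolutionOfSingularities-15315, chain w45a; res-L1-w45a-plan-1 RULING R19.23 «NEG-T», brick (T1); seat res-L1-w45a-lead-1 g9;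
# diagnosis and paper check res-L1-w45a-tri-2 g16, bus l.81780 / l.81871)

[OURS · L1 W4.5a] Support file (`--supports stmt-ResolutionOfSingularities-15315 --as helper`); def-free, fact-free, UNCONDITIONAL. Nothing of the crux is proved. AI-written (weaker than expert review).

* §1 `isReduced_pullback_subschemeι`, `isReduced_subscheme_comap` — along a flat preimmersion `f : S′ ⟶ S` (all stalk maps are isomorphisms, Literature `isIso_stalkMap_of_flat_of_isPreimmersion`)
  the pulled-back closed subscheme of a REDUCED closed subscheme is reduced; ★ `comap_vanishingIdeal_of_flat_preimmersion : (vanishingIdeal Z).comap f = vanishingIdeal (f⁻¹ Z)`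
  (reduced-subscheme uniqueness, Literature `eq_vanishingIdeal_support_of_isReduced_subscheme`; the open-immersion case is Literature `comap_vanishingIdeal_of_isOpenImmersion`).
* §2 `preimage_nonFullLocus`, `preimage_compl_regularLocus` (flat preimmersions; stalk conditions), `preimage_closure_of_subset_range` (closure inside a topological embedding),
  ★★ `nonFullCentre_comap : closure (nonFullLocus p S) ⊆ range f → (nonFullCentre p S).comap f = nonFullCentre p S′` = (T1).
* §3 ★★ `recipeTowerFull_nonFullCentre_of_pullback_fromSpecStalk` / `exists_…` — NEG-T for `N_red` WITHOUT the `hcomap` hypothesis of p646420: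
  `h : T ⟶ X`, `v` closed, `T` FULL off `h⁻¹ v` ⟹ `RecipeTowerFull nonFullCentre p n (pullback h (X.fromSpecStalk v)) → RecipeTowerFull nonFullCentre p n T`.
[cite: GortzWedhorn2020, Prop. 13.91 (2)] [cite: StacksProject, Tag 01J3; Tag 01J7] [cite: Temkin2008, §2.1]
-/

-- single-problem summit: the doubled namespace component is forced
set_option linter.dupNamespace false

noncomputable section

open AlgebraicGeometry CategoryTheory CategoryTheory.Limits Literature.AlgebraicGeometry.Resolution TopologicalSpace IsLocalRing

namespace Summit.ResolutionOfSingularities.ResolutionOfSingularities.Theorems.FInjectiveMacaulayfication.RecipeTowerTransfer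

open Summit.ResolutionOfSingularities.ResolutionOfSingularities.Theorems.FInjectiveMacaulayfication
open SliceableCentre IntrinsicTower IntrinsicTower.Recipes FullCentreDescent Scheme.IdealSheafData

/-! ## §1 Reduced closed subschemes pull back to reduced closed subschemes along flat preimmersions -/

/-- The fibre product of a reduced closed subscheme with a flat preimmersion is reduced (its stalks are those of the subscheme). [folklore] -/
theorem isReduced_pullback_subschemeι {S S' : Scheme.{0}} (f : S' ⟶ S) [Flat f] [IsPreimmersion f] (C : S.IdealSheafData) [IsReduced C.subscheme] :
    IsReduced (pullback f C.subschemeι) := by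
  haveI : ∀ z : ↑(pullback f C.subschemeι), _root_.IsReduced ((pullback f C.subschemeι).presheaf.stalk z) := by
    intro z
    haveI := isIso_stalkMap_of_flat_of_isPreimmersion (pullback.snd f C.subschemeι) z
    let e := (asIso ((pullback.snd f C.subschemeι).stalkMap z)).commRingCatIsoToRingEquiv
    exact isReduced_of_injective e.symm.toRingHom e.symm.injective
  exact isReduced_of_isReduced_stalk _

/-- The closed subscheme of the pulled-back ideal sheaf of a reduced closed subscheme along a flat preimmersion is reduced. [folklore] -/
theorem isReduced_subscheme_comap {S S' : Scheme.{0}} (f : S' ⟶ S) [Flat f] [IsPreimmersion f] (C : S.IdealSheafData) [IsReduced C.subscheme] :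
    IsReduced (C.comap f).subscheme := by
  haveI := isReduced_pullback_subschemeι f C
  exact isReduced_of_isOpenImmersion (C.comapIso f).hom

/-- ★ **Vanishing ideal sheaves pull back along flat preimmersions**: `(𝓘_Z)·𝒪_{S′} = 𝓘_{f⁻¹ Z}` for `f : S′ ⟶ S` a flat preimmersion (e.g. `T ×_X Spec 𝒪_{X,v} ⟶ T`). [folklore; Stacks 01J3] -/
theorem comap_vanishingIdeal_of_flat_preimmersion {S S' : Scheme.{0}} (f : S' ⟶ S) [Flat f] [IsPreimmersion f] (Z : Closeds S) :
    (vanishingIdeal Z).comap f = vanishingIdeal (Z.preimage f.continuous) := by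
  haveI : IsReduced (vanishingIdeal Z).subscheme := ComponentGluing.isReduced_subscheme_vanishingIdeal Z
  haveI := isReduced_subscheme_comap f (vanishingIdeal Z)
  rw [← eq_vanishingIdeal_support_of_isReduced_subscheme ((vanishingIdeal Z).comap f), support_comap]
  rfl

/-! ## §2 (T1) for the `N_red` recipe -/

/-- The non-FULL locus pulls back along flat preimmersions. [folklore] -/
theorem preimage_nonFullLocus (p : ℕ) {S S' : Scheme.{0}} (f : S' ⟶ S) [Flat f] [IsPreimmersion f] :
    f.base ⁻¹' nonFullLocus p S = nonFullLocus p S' := by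
  ext u
  simp only [Set.mem_preimage, IntrinsicTower.nonFullLocus, Set.mem_setOf_eq]
  haveI : IsIso (f.stalkMap u) := isIso_stalkMap_of_flat_of_isPreimmersion f u
  exact not_congr (fullCl_stalk_iff_of_isIso_stalkMap p f u)

/-- The singular locus pulls back along flat preimmersions. [folklore] -/
theorem preimage_compl_regularLocus {S S' : Scheme.{0}} (f : S' ⟶ S) [Flat f] [IsPreimmersion f] :
    f.base ⁻¹' (Scheme.regularLocus S)ᶜ = (Scheme.regularLocus S')ᶜ := by
  ext u
  simp only [Set.mem_preimage, Set.mem_compl_iff, mem_regularLocus_iff_of_flat_of_isPreimmersion f u]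

/-- Closure inside a topological embedding: for `A ⊆ range f`, `f⁻¹ (closure A) = closure (f⁻¹ A)`. [folklore] -/
theorem preimage_closure_of_subset_range {S S' : Scheme.{0}} (f : S' ⟶ S) [IsPreimmersion f] (A : Set S) (hA : A ⊆ Set.range f.base) :
    f.base ⁻¹' closure A = closure (f.base ⁻¹' A) := by
  rw [f.isEmbedding.isInducing.closure_eq_preimage_closure_image, Set.image_preimage_eq_of_subset hA]

/-- ★★ **(T1) THE `N_red` CENTRE COMMUTES WITH FLAT PREIMMERSIONS whose range contains the closure of the non-FULL locus** (the hypothesis `hcomap` of p646420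
`recipeTowerFull_nonFullCentre_of_pullback_fromSpecStalk`, discharged). [OURS · folklore assembly] -/
theorem nonFullCentre_comap (p : ℕ) {S S' : Scheme.{0}} (f : S' ⟶ S) [Flat f] [IsPreimmersion f]
    (hrange : closure (nonFullLocus p S) ⊆ Set.range f.base) : (nonFullCentre p S).comap f = nonFullCentre p S' := by
  have hA : nonFullLocus p S ∩ (Scheme.regularLocus S)ᶜ ⊆ Set.range f.base := fun s hs => hrange (subset_closure hs.1)
  change (vanishingIdeal _).comap f = vanishingIdeal _
  rw [comap_vanishingIdeal_of_flat_preimmersion]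
  congr 1
  ext1
  rw [Closeds.coe_preimage]
  change f.base ⁻¹' closure (nonFullLocus p S ∩ (Scheme.regularLocus S)ᶜ) = closure (nonFullLocus p S' ∩ (Scheme.regularLocus S')ᶜ)
  rw [preimage_closure_of_subset_range f _ hA, Set.preimage_inter, preimage_nonFullLocus p f, preimage_compl_regularLocus f]

/-! ## §3 ★★ NEG-T for `N_red`, hypothesis-free -/

/-- ★★ **NEG-T FOR `N_red`.** `h : T ⟶ X`, `v ∈ X` a closed point, `T` FULL at every point not over `v`: every bound on the `N_red`-towers of the LOCAL floor `T ×_X Spec 𝒪_{X,v}` is a bound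
on the `N_red`-towers of `T`. [OURS · GW 13.91 (2), Temkin 2008 §2.1, Stacks 01J3] -/
theorem recipeTowerFull_nonFullCentre_of_pullback_fromSpecStalk' (p : ℕ) {X T : Scheme.{0}} (h : T ⟶ X) (v : X) (hv : IsClosed ({v} : Set X))
    (hfull : ∀ s : T, h.base s ≠ v → FullCl p (T.presheaf.stalk s)) (n : ℕ)
    (hT : RecipeTowerFull nonFullCentre p n (pullback h (X.fromSpecStalk v))) : RecipeTowerFull nonFullCentre p n T :=
  recipeTowerFull_nonFullCentre_of_pullback_fromSpecStalk p (fun f _ _ hr => nonFullCentre_comap p f hr) h v hv hfull n hT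

/-- The same with an existential height (the conjecture's conclusion shape). [OURS] -/
theorem exists_recipeTowerFull_nonFullCentre_of_pullback_fromSpecStalk' (p : ℕ) {X T : Scheme.{0}} (h : T ⟶ X) (v : X) (hv : IsClosed ({v} : Set X))
    (hfull : ∀ s : T, h.base s ≠ v → FullCl p (T.presheaf.stalk s))
    (hT : ∃ n : ℕ, RecipeTowerFull nonFullCentre p n (pullback h (X.fromSpecStalk v))) : ∃ n : ℕ, RecipeTowerFull nonFullCentre p n T :=
  exists_recipeTowerFull_nonFullCentre_of_pullback_fromSpecStalk p (fun f _ _ hr => nonFullCentre_comap p f hr) h v hv hfull hT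

end Summit.ResolutionOfSingularities.ResolutionOfSingularities.Theorems.FInjectiveMacaulayfication.RecipeTowerTransfer

end
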